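import Summits.Parity.GeneralizedHardyLittlewood.Theorems.LiouvilleShiftedTablesPairsToGHLStubRungAtomsAux2
import Literature.NumberTheory.Sieve.BombieriVinogradovReduction

/-!
# Sloped ladder, rung — atoms piece, part 3: the tail `j > J` and the main part `j ≤ J`

Route `LiouvilleShiftedTables` (Parity / GeneralizedHardyLittlewood), crux stmt-Parity-9389 (`PairsToGHL`),
line `sloped_ladder`, stub `stub_rungAtomsPart` (lead).  With `m(n) = a n + b` (`a ≥ 1`),
`U_q(N) = Σ_{n ≤ N, q ∣ m(n)} λ(m(n)) F(n)` and `0 ≤ F ≤ F_max` on `[1, N]`: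

* `sum_le_sum_of_injOn'` — comparison along an injection (the harmonic bound `Σ_{e ≤ M} 1/e ≤ 1 + log M` is the
  tree's `Literature.NumberTheory.Sieve.harmonic_Icc_le`);
* `tail_bound` — `Σ_{e ≤ M₀} log e Σ_{J < j ≤ J'} |U_{ej²}(N)| ≤ log M₀ · F_max (a+b)N (1 + log M₀) · 2/(J+1)`;
* `main_bound_fixed` — for fixed `j ≥ 1` with `M₀ j² ≤ Q`: `Σ_{e ≤ M₀} |U_{ej²}(N)| ≤ τ(a) · B` whenever every
  one-class-per-modulus sum `Σ_{q ≤ Q} |Σ_{n ≤ N, n ≡ w(q) (q)} λ(m(n))F(n)|` is `≤ B` (re-indexing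
  `e ↦ ej²/gcd(a, ej²)`, injective for each value of the gcd, which runs over the divisors of `a`);
* `atoms_abs_le` — the two combined: `|A(N)| ≤ log M₀ (J τ(a) B + F_max (a+b) N (1 + log M₀) 2/(J+1))`.

[folklore]
-/

open Finset

namespace Summit.Parity.GeneralizedHardyLittlewood.Theorems.PairsToGHL.SlopedLadder

namespace RungAtoms

open scoped ArithmeticFunction.Moebius

/-! ### Harmonic and square tails -/

/-- **Tail.** `Σ_{e ≤ M₀} log e · Σ_{J < j ≤ J'} |U_{ej²}(N)| ≤ log M₀ · (F_max (a+b) N (1 + log M₀) · 2/(J+1))`.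
[folklore] -/
theorem tail_bound {a : ℕ} (ha : 0 < a) (b : ℕ) {F : ℕ → ℝ} {Fb : ℝ} {N : ℕ} (hF0 : ∀ n, 0 ≤ F n)
    (hFb0 : 0 ≤ Fb) (hFb : ∀ n ∈ Icc 1 N, F n ≤ Fb) (M₀ J J' : ℕ) :
    ∑ e ∈ Icc 1 M₀, Real.log e * ∑ j ∈ Ioc J J',
        |∑ n ∈ (Icc 1 N).filter (fun n : ℕ => e * j ^ 2 ∣ a * n + b),
          ((ArithmeticFunction.liouville (a * n + b) : ℤ) : ℝ) * F n| ≤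
      Real.log M₀ * (Fb * ((a + b) * N : ℕ) * (1 + Real.log M₀) * (2 / (J + 1))) := by
  -- per `(e, j)`: `|U| ≤ Fb (a+b)N · (1/e) · (1/j²)`
  have hU : ∀ e ∈ Icc 1 M₀, ∀ j ∈ Ioc J J',
      |∑ n ∈ (Icc 1 N).filter (fun n : ℕ => e * j ^ 2 ∣ a * n + b),
          ((ArithmeticFunction.liouville (a * n + b) : ℤ) : ℝ) * F n| ≤
        Fb * ((a + b) * N : ℕ) * (((e : ℝ))⁻¹ * (((j : ℝ)) ^ 2)⁻¹) := by
    intro e he j hj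
    have he1 : (1 : ℝ) ≤ e := by exact_mod_cast (Finset.mem_Icc.mp he).1
    have hj1 : (1 : ℝ) ≤ j := by
      have := (Finset.mem_Ioc.mp hj).1
      exact_mod_cast (show 1 ≤ j by omega)
    refine (abs_U_le ha b hF0 hFb0 hFb (e * j ^ 2)).trans ?_
    rw [mul_assoc]
    refine mul_le_mul_of_nonneg_left ?_ hFb0
    have hq : (0 : ℝ) < (e : ℝ) * (j : ℝ) ^ 2 := by positivity
    calc ((((a + b) * N / (e * j ^ 2) : ℕ) : ℝ)) ≤ (((a + b) * N : ℕ) : ℝ) / ((e * j ^ 2 : ℕ) : ℝ) :=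
          Nat.cast_div_le
      _ = (((a + b) * N : ℕ) : ℝ) * (((e : ℝ))⁻¹ * (((j : ℝ)) ^ 2)⁻¹) := by
          push_cast
          rw [div_eq_mul_inv, mul_inv]
  have hlogM : ∀ e ∈ Icc 1 M₀, Real.log e ≤ Real.log M₀ := fun e he =>
    Real.log_le_log (by exact_mod_cast (Finset.mem_Icc.mp he).1) (by exact_mod_cast (Finset.mem_Icc.mp he).2)
  have hlog0 : ∀ e ∈ Icc 1 M₀, 0 ≤ Real.log e := fun e he =>
    Real.log_nonneg (by exact_mod_cast (Finset.mem_Icc.mp he).1)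
  have hM0 : 0 ≤ Real.log M₀ := by
    rcases Nat.eq_zero_or_pos M₀ with h | h
    · simp [h]
    · exact Real.log_nonneg (by exact_mod_cast h)
  set K : ℝ := Fb * ((a + b) * N : ℕ) with hK
  have hK0 : 0 ≤ K := by positivity
  have hsq : ∑ j ∈ Ioc J J', (((j : ℝ)) ^ 2)⁻¹ ≤ 2 / (J + 1) :=
    calc ∑ j ∈ Ioc J J', (((j : ℝ)) ^ 2)⁻¹ ≤ ∑ j ∈ Ioo J (J' + 1), (((j : ℝ)) ^ 2)⁻¹ :=
          Finset.sum_le_sum_of_subset_of_nonneg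
            (fun k hk => by rw [Finset.mem_Ioc] at hk; rw [Finset.mem_Ioo]; omega) (fun _ _ _ => by positivity)
      _ ≤ 2 / (J + 1) := _root_.sum_Ioo_inv_sq_le J (J' + 1)
  calc ∑ e ∈ Icc 1 M₀, Real.log e * ∑ j ∈ Ioc J J',
          |∑ n ∈ (Icc 1 N).filter (fun n : ℕ => e * j ^ 2 ∣ a * n + b),
            ((ArithmeticFunction.liouville (a * n + b) : ℤ) : ℝ) * F n|
      ≤ ∑ e ∈ Icc 1 M₀, Real.log M₀ * ∑ j ∈ Ioc J J', K * (((e : ℝ))⁻¹ * (((j : ℝ)) ^ 2)⁻¹) := by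
        refine Finset.sum_le_sum fun e he => ?_
        refine mul_le_mul (hlogM e he) (Finset.sum_le_sum fun j hj => hU e he j hj)
          (Finset.sum_nonneg fun j _ => abs_nonneg _) hM0
    _ = Real.log M₀ * (K * ((∑ e ∈ Icc 1 M₀, ((e : ℝ))⁻¹) * ∑ j ∈ Ioc J J', (((j : ℝ)) ^ 2)⁻¹)) := by
        rw [← Finset.mul_sum]
        congr 1
        rw [Finset.sum_mul, Finset.mul_sum]
        refine Finset.sum_congr rfl fun e _ => ?_
        rw [Finset.mul_sum, Finset.mul_sum]
    _ ≤ Real.log M₀ * (K * ((1 + Real.log M₀) * (2 / (J + 1)))) := by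
        refine mul_le_mul_of_nonneg_left (mul_le_mul_of_nonneg_left ?_ hK0) hM0
        exact mul_le_mul (Literature.NumberTheory.Sieve.harmonic_Icc_le M₀) hsq
          (Finset.sum_nonneg fun j _ => by positivity) (by linarith)
    _ = Real.log M₀ * (Fb * ((a + b) * N : ℕ) * (1 + Real.log M₀) * (2 / (J + 1))) := by rw [hK]; ring

/-- Comparison along an injection: if `φ` is injective on `s`, maps `s` into `t`, `f i ≤ g (φ i)` on `s` and
`0 ≤ g` on `t`, then `Σ_{i ∈ s} f i ≤ Σ_{j ∈ t} g j`. [folklore] -/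
theorem sum_le_sum_of_injOn' {ι κ : Type*} [DecidableEq κ] {s : Finset ι} {t : Finset κ} {f : ι → ℝ}
    {g : κ → ℝ} (φ : ι → κ) (hφ : Set.InjOn φ s) (hst : ∀ i ∈ s, φ i ∈ t) (hg : ∀ j ∈ t, 0 ≤ g j)
    (h : ∀ i ∈ s, f i ≤ g (φ i)) : ∑ i ∈ s, f i ≤ ∑ j ∈ t, g j :=
  calc ∑ i ∈ s, f i ≤ ∑ i ∈ s, g (φ i) := Finset.sum_le_sum h
    _ = ∑ j ∈ s.image φ, g j := (Finset.sum_image hφ).symm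
    _ ≤ ∑ j ∈ t, g j :=
        Finset.sum_le_sum_of_subset_of_nonneg (Finset.image_subset_iff.mpr hst) fun j hj _ => hg j hj

/-! ### The main part for a fixed `j`: re-indexing and the one-class hypothesis -/

/-- **Main part, fixed `j`.** If every one-class-per-modulus sum up to level `Q` is `≤ B`, then for `j ≥ 1`
with `M₀ j² ≤ Q`: `Σ_{e ≤ M₀} |U_{ej²}(N)| ≤ τ(a) · B`. [folklore] -/
theorem main_bound_fixed {a : ℕ} (ha : 0 < a) (b : ℕ) (F : ℕ → ℝ) (N : ℕ) {M₀ Q j : ℕ} (hj : 0 < j)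
    (hQ : M₀ * j ^ 2 ≤ Q) {B : ℝ}
    (hB : ∀ w : ℕ → ℕ, ∑ q ∈ Icc 1 Q, |∑ n ∈ (Icc 1 N).filter (fun n : ℕ => n ≡ w q [MOD q]),
        ((ArithmeticFunction.liouville (a * n + b) : ℤ) : ℝ) * F n| ≤ B) :
    ∑ e ∈ Icc 1 M₀, |∑ n ∈ (Icc 1 N).filter (fun n : ℕ => e * j ^ 2 ∣ a * n + b),
        ((ArithmeticFunction.liouville (a * n + b) : ℤ) : ℝ) * F n| ≤ #(Nat.divisors a) * B := by
  classical
  -- the class function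
  have hcls : ∀ q : ℕ, ∃ ρ : ℕ, 0 < q → ∀ (N : ℕ) (G : ℕ → ℝ),
      ∑ n ∈ (Icc 1 N).filter (fun n : ℕ => q ∣ a * n + b), G n =
        if Nat.gcd a q ∣ b then ∑ n ∈ (Icc 1 N).filter (fun n : ℕ => n ≡ ρ [MOD (q / Nat.gcd a q)]), G n
        else 0 := by
    intro q
    rcases Nat.eq_zero_or_pos q with hq | hq
    · exact ⟨0, fun h => absurd h (by omega)⟩
    · obtain ⟨ρ, -, hρ⟩ := exists_class_sum ha hq b
      exact ⟨ρ, fun _ => hρ⟩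
  choose cls hcls using hcls
  set G : ℕ → ℝ := fun n => ((ArithmeticFunction.liouville (a * n + b) : ℤ) : ℝ) * F n with hG
  set V : ℕ → ℕ → ℝ := fun q r => ∑ n ∈ (Icc 1 N).filter (fun n : ℕ => n ≡ r [MOD q]), G n with hV
  have hB0 : 0 ≤ B := le_trans (Finset.sum_nonneg fun q _ => abs_nonneg _) (hB fun _ => 0)
  -- split `e` according to `g = gcd(a, e j²) ∈ divisors a`
  have hmaps : ∀ e ∈ Icc 1 M₀, Nat.gcd a (e * j ^ 2) ∈ Nat.divisors a := fun e _ =>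
    Nat.mem_divisors.mpr ⟨Nat.gcd_dvd_left _ _, ha.ne'⟩
  rw [← Finset.sum_fiberwise_of_maps_to hmaps]
  have hcard : (#(Nat.divisors a) : ℝ) * B = ∑ _g ∈ Nat.divisors a, B := by
    rw [Finset.sum_const, nsmul_eq_mul]
  rw [hcard]
  refine Finset.sum_le_sum fun g hg => ?_
  have hg0 : 0 < g := Nat.pos_of_mem_divisors hg
  -- for fixed `g`: inject `e ↦ e j² / g` into `[1, Q]`
  calc ∑ e ∈ (Icc 1 M₀).filter (fun e => Nat.gcd a (e * j ^ 2) = g),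
          |∑ n ∈ (Icc 1 N).filter (fun n : ℕ => e * j ^ 2 ∣ a * n + b), G n|
      ≤ ∑ q ∈ Icc 1 Q, |V q (cls (g * q))| := by
        refine sum_le_sum_of_injOn' (fun e => e * j ^ 2 / g) ?_ ?_ (fun q _ => abs_nonneg _) ?_
        · -- injective
          intro e₁ he₁ e₂ he₂ h
          rw [Finset.coe_filter, Set.mem_setOf_eq] at he₁ he₂
          have hd₁ : g ∣ e₁ * j ^ 2 := he₁.2 ▸ Nat.gcd_dvd_right _ _
          have hd₂ : g ∣ e₂ * j ^ 2 := he₂.2 ▸ Nat.gcd_dvd_right _ _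
          have h' : e₁ * j ^ 2 / g = e₂ * j ^ 2 / g := h
          have : e₁ * j ^ 2 = e₂ * j ^ 2 := by
            rw [← Nat.div_mul_cancel hd₁, ← Nat.div_mul_cancel hd₂, h']
          exact Nat.eq_of_mul_eq_mul_right (by positivity) this
        · -- maps into `[1, Q]`
          intro e he
          rw [Finset.mem_filter, Finset.mem_Icc] at he
          obtain ⟨⟨he1, heM⟩, hge⟩ := he
          have hd : g ∣ e * j ^ 2 := hge ▸ Nat.gcd_dvd_right _ _
          have hej : 0 < e * j ^ 2 := by positivity
          rw [Finset.mem_Icc]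
          refine ⟨Nat.div_pos (Nat.le_of_dvd hej hd) hg0, (Nat.div_le_self _ _).trans ?_⟩
          exact (Nat.mul_le_mul_right _ heM).trans hQ
        · intro e he
          rw [Finset.mem_filter, Finset.mem_Icc] at he
          obtain ⟨⟨he1, -⟩, hge⟩ := he
          have hej : 0 < e * j ^ 2 := by positivity
          have hd : g ∣ e * j ^ 2 := hge ▸ Nat.gcd_dvd_right _ _
          have hspec := hcls (e * j ^ 2) hej N G
          change |∑ n ∈ (Icc 1 N).filter (fun n : ℕ => e * j ^ 2 ∣ a * n + b), G n| ≤
            |V (e * j ^ 2 / g) (cls (g * (e * j ^ 2 / g)))|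
          rw [hspec, hge, Nat.mul_div_cancel' hd]
          split_ifs
          · exact le_rfl
          · rw [abs_zero]; exact abs_nonneg _
    _ ≤ B := hB fun q => cls (g * q)

/-! ### Both parts combined -/

/-- **The atoms piece, abstract form.** For `a ≥ 1`, `0 ≤ F ≤ F_max` on `[1,N]`, `J ≤ J'`, `(a+b)N ≤ J'`,
`M₀ J² ≤ Q` and a one-class-per-modulus bound `B` at level `Q`:
`|Σ_{n≤N} F(n) Σ_{e ≤ M₀, e ∣ m(n)} μ(m(n)/e) log e| ≤ log M₀ · (J τ(a) B + F_max (a+b)N (1 + log M₀) 2/(J+1))`.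
[folklore] -/
theorem atoms_abs_le {a : ℕ} (ha : 0 < a) (b : ℕ) {F : ℕ → ℝ} {Fb : ℝ} {N : ℕ} (hF0 : ∀ n, 0 ≤ F n)
    (hFb0 : 0 ≤ Fb) (hFb : ∀ n ∈ Icc 1 N, F n ≤ Fb) {M₀ J J' Q : ℕ} (hJJ' : J ≤ J')
    (hJ' : (a + b) * N ≤ J') (hQ : M₀ * J ^ 2 ≤ Q) {B : ℝ}
    (hB : ∀ w : ℕ → ℕ, ∑ q ∈ Icc 1 Q, |∑ n ∈ (Icc 1 N).filter (fun n : ℕ => n ≡ w q [MOD q]),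
        ((ArithmeticFunction.liouville (a * n + b) : ℤ) : ℝ) * F n| ≤ B) :
    |∑ n ∈ Icc 1 N, F n * ∑ e ∈ (Icc 1 M₀).filter (fun e : ℕ => e ∣ a * n + b),
        ((μ ((a * n + b) / e) : ℤ) : ℝ) * Real.log e| ≤
      Real.log M₀ * ((J : ℝ) * #(Nat.divisors a) * B) +
        Real.log M₀ * (Fb * ((a + b) * N : ℕ) * (1 + Real.log M₀) * (2 / (J + 1))) := by
  have hB0 : 0 ≤ B := le_trans (Finset.sum_nonneg fun q _ => abs_nonneg _) (hB fun _ => 0)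
  have hlogM : ∀ e ∈ Icc 1 M₀, Real.log e ≤ Real.log M₀ := fun e he =>
    Real.log_le_log (by exact_mod_cast (Finset.mem_Icc.mp he).1) (by exact_mod_cast (Finset.mem_Icc.mp he).2)
  have hlog0 : ∀ e ∈ Icc 1 M₀, 0 ≤ Real.log e := fun e he =>
    Real.log_nonneg (by exact_mod_cast (Finset.mem_Icc.mp he).1)
  have hM0 : 0 ≤ Real.log M₀ := by
    rcases Nat.eq_zero_or_pos M₀ with h | h
    · simp [h]
    · exact Real.log_nonneg (by exact_mod_cast h)
  rw [atoms_sum_swap a b F N M₀]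
  -- per `e`: `|T_e| ≤ Σ_{j ≤ J} |U| + Σ_{J < j ≤ J'} |U|`
  have hsplit : ∀ e ∈ Icc 1 M₀,
      |∑ n ∈ (Icc 1 N).filter (fun n : ℕ => e ∣ a * n + b), ((μ ((a * n + b) / e) : ℤ) : ℝ) * F n| ≤
        ∑ j ∈ Icc 1 J, |∑ n ∈ (Icc 1 N).filter (fun n : ℕ => e * j ^ 2 ∣ a * n + b),
            ((ArithmeticFunction.liouville (a * n + b) : ℤ) : ℝ) * F n| +
        ∑ j ∈ Ioc J J', |∑ n ∈ (Icc 1 N).filter (fun n : ℕ => e * j ^ 2 ∣ a * n + b),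
            ((ArithmeticFunction.liouville (a * n + b) : ℤ) : ℝ) * F n| := by
    intro e he
    have he0 : e ≠ 0 := by have := (Finset.mem_Icc.mp he).1; omega
    refine (abs_T_le ha b F he0 hJ').trans (le_of_eq ?_)
    rw [← Finset.sum_union (Finset.disjoint_left.mpr fun j hj hj' => by
      rw [Finset.mem_Icc] at hj; rw [Finset.mem_Ioc] at hj'; omega)]
    congr 1
    ext j
    simp only [Finset.mem_union, Finset.mem_Icc, Finset.mem_Ioc]
    omega
  calc |∑ e ∈ Icc 1 M₀, Real.log e *
          ∑ n ∈ (Icc 1 N).filter (fun n : ℕ => e ∣ a * n + b), ((μ ((a * n + b) / e) : ℤ) : ℝ) * F n|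
      ≤ ∑ e ∈ Icc 1 M₀, Real.log e *
          |∑ n ∈ (Icc 1 N).filter (fun n : ℕ => e ∣ a * n + b), ((μ ((a * n + b) / e) : ℤ) : ℝ) * F n| := by
        refine (Finset.abs_sum_le_sum_abs _ _).trans (le_of_eq (Finset.sum_congr rfl fun e he => ?_))
        rw [abs_mul, abs_of_nonneg (hlog0 e he)]
    _ ≤ ∑ e ∈ Icc 1 M₀, Real.log e *
          (∑ j ∈ Icc 1 J, |∑ n ∈ (Icc 1 N).filter (fun n : ℕ => e * j ^ 2 ∣ a * n + b),
              ((ArithmeticFunction.liouville (a * n + b) : ℤ) : ℝ) * F n| +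
           ∑ j ∈ Ioc J J', |∑ n ∈ (Icc 1 N).filter (fun n : ℕ => e * j ^ 2 ∣ a * n + b),
              ((ArithmeticFunction.liouville (a * n + b) : ℤ) : ℝ) * F n|) :=
        Finset.sum_le_sum fun e he => mul_le_mul_of_nonneg_left (hsplit e he) (hlog0 e he)
    _ = ∑ e ∈ Icc 1 M₀, Real.log e *
          ∑ j ∈ Icc 1 J, |∑ n ∈ (Icc 1 N).filter (fun n : ℕ => e * j ^ 2 ∣ a * n + b),
              ((ArithmeticFunction.liouville (a * n + b) : ℤ) : ℝ) * F n| +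
        ∑ e ∈ Icc 1 M₀, Real.log e *
          ∑ j ∈ Ioc J J', |∑ n ∈ (Icc 1 N).filter (fun n : ℕ => e * j ^ 2 ∣ a * n + b),
              ((ArithmeticFunction.liouville (a * n + b) : ℤ) : ℝ) * F n| := by
        rw [← Finset.sum_add_distrib]
        exact Finset.sum_congr rfl fun e _ => by ring
    _ ≤ Real.log M₀ * ((J : ℝ) * #(Nat.divisors a) * B) +
        Real.log M₀ * (Fb * ((a + b) * N : ℕ) * (1 + Real.log M₀) * (2 / (J + 1))) := by
        refine add_le_add ?_ (tail_bound ha b hF0 hFb0 hFb M₀ J J')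
        -- main part: `log e ≤ log M₀`, swap, per-`j` bound
        calc ∑ e ∈ Icc 1 M₀, Real.log e *
              ∑ j ∈ Icc 1 J, |∑ n ∈ (Icc 1 N).filter (fun n : ℕ => e * j ^ 2 ∣ a * n + b),
                ((ArithmeticFunction.liouville (a * n + b) : ℤ) : ℝ) * F n|
            ≤ ∑ e ∈ Icc 1 M₀, Real.log M₀ *
              ∑ j ∈ Icc 1 J, |∑ n ∈ (Icc 1 N).filter (fun n : ℕ => e * j ^ 2 ∣ a * n + b),
                ((ArithmeticFunction.liouville (a * n + b) : ℤ) : ℝ) * F n| :=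
              Finset.sum_le_sum fun e he => mul_le_mul_of_nonneg_right (hlogM e he)
                (Finset.sum_nonneg fun j _ => abs_nonneg _)
          _ = Real.log M₀ * ∑ j ∈ Icc 1 J, ∑ e ∈ Icc 1 M₀,
              |∑ n ∈ (Icc 1 N).filter (fun n : ℕ => e * j ^ 2 ∣ a * n + b),
                ((ArithmeticFunction.liouville (a * n + b) : ℤ) : ℝ) * F n| := by
              rw [← Finset.mul_sum, Finset.sum_comm]
          _ ≤ Real.log M₀ * ∑ _j ∈ Icc 1 J, (#(Nat.divisors a) : ℝ) * B := by
              refine mul_le_mul_of_nonneg_left (Finset.sum_le_sum fun j hj => ?_) hM0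
              have hj1 : 0 < j := (Finset.mem_Icc.mp hj).1
              have hjJ : j ≤ J := (Finset.mem_Icc.mp hj).2
              exact main_bound_fixed ha b F N hj1
                ((Nat.mul_le_mul_left _ (Nat.pow_le_pow_left hjJ 2)).trans hQ) hB
          _ = Real.log M₀ * ((J : ℝ) * #(Nat.divisors a) * B) := by
              rw [Finset.sum_const, Nat.card_Icc, nsmul_eq_mul]
              push_cast
              ring

end RungAtoms

/-- **Registered sub-goal `stub_rungAtomsPart_part3`** (the abstract atoms bound, uncurried form of `RungAtoms.atoms_abs_le`). [folklore] -/
theorem stub_rungAtomsPart_part3 : ∀ (a b : ℕ) (F : ℕ → ℝ) (Fb B : ℝ) (N M₀ J J' Q : ℕ), 0 < a → (∀ n, 0 ≤ F n) → 0 ≤ Fb → (∀ n ∈ Finset.Icc 1 N, F n ≤ Fb) → J ≤ J' → (a + b) * N ≤ J' → M₀ * J ^ 2 ≤ Q → (∀ w : ℕ → ℕ, ∑ q ∈ Finset.Icc 1 Q, |∑ n ∈ (Finset.Icc 1 N).filter (fun n : ℕ => n ≡ w q [MOD q]), ((ArithmeticFunction.liouville (a * n + b) : ℤ) : ℝ)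 * F n| ≤ B) → |∑ n ∈ Finset.Icc 1 N, F n * ∑ e ∈ (Finset.Icc 1 M₀).filter (fun e : ℕ => e ∣ a * n + b), ((ArithmeticFunction.moebius ((a * n + b) / e) : ℤ) : ℝ) * Real.log e| ≤ Real.log M₀ * ((J : ℝ) * (Nat.divisors a).card * B) + Real.log M₀ * (Fb * ((a + b) * N : ℕ) * (1 + Real.log M₀) * (2 / (J + 1))) :=
  fun _ b _ _ _ _ _ _ _ _ ha hF0 hFb0 hFb hJJ hJ hQ hB =>
    RungAtoms.atoms_abs_le ha b hF0 hFb0 hFb hJJ hJ hQ hB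

end Summit.Parity.GeneralizedHardyLittlewood.Theorems.PairsToGHL.SlopedLadder
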